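import Literature.Analysis.FluidPDE.RenormalizedDiffusivityCascade
import HarnessLib

/-!
# Armstrong–Vicol's cascade of renormalised diffusivities, Lemma 3.4 — proofs

Companion to `RenormalizedDiffusivityCascade.lean` (definitions: the exponents (2.2)/(2.5)/(2.7),
the model recursion (3.47) `enhanceStep`/`modelDiffusivity`, the scale-sequence hypotheses
(2.8)–(2.10) `IsScaleSequence`; see its module docstring for the source, the scope and what is
deliberately not transcribed). Everything here is PROVED:

* the "routine" parameter identities of §2.1: (2.3) `beta_eq_of_qExp`, (2.4) `one_lt_qExp` /
  `qExp_lt`, (2.5) `deltaExp_eq_sq`, `δ ∈ (0, 1/16]` (`deltaExp_sq_pos_le`), `0 < γ < β`,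
  `q (β - γ) = β + γ` ((3.52)), `2β/(q+1) = β - γ` ((3.43)–(3.44)), `aₘ εₘ^{2+γ} = εₘ^{β+γ}` ((3.48));
* API of the model recursion (positivity, `κ'_M = κ`, the upward recursion, monotonicity) and of
  `IsScaleSequence` (`εₘ₊₁ ≤ 2⁻⁷ εₘ ≤ εₘ ≤ 1`, `εₘ ≤ 2⁻⁷` for `m ≥ 1`);
* **Step 1 of the proof of Lemma 3.4 ((3.49) p. 44)**, `modelDiffusivity_bounds`, through the
  printed chain: the rescaled recursion (3.51) (`enhanceStep_rescale`), the one-step inequality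
  before (3.54) (`max_step_le`), the ratio factor (3.52)–(3.53) (`max_rpow_inv_le_exp`), the first
  step (`base_window`) and the product bound (3.54) as a telescoping potential (`cascade_bound`).

## References

* S. Armstrong, V. Vicol, *Anomalous diffusion by fractal homogenization*, Ann. PDE 11 (2025),
  no. 1, Paper No. 2 (doi:10.1007/s40818-024-00189-6; arXiv:2305.05048v3), §2.1 pp. 18–19,
  §3.3 pp. 42–45 (Lemma 3.4 p. 43, proof pp. 44–45). [`ArmstrongVicol2025`]
-/

open Real

namespace Literature.Analysis.FluidPDE

namespace ArmstrongVicol2025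

/-! ### The exponents of §2.1 -/

/-- (2.4), lower half: `1 < q` as soon as `β < 4/3`. [cite: ArmstrongVicol2025, §2.1 (2.4) p. 18] -/
theorem one_lt_qExp {β : ℝ} (h1 : 1 < β) (h2 : β < 4 / 3) : 1 < qExp β := by
  unfold qExp
  have h : 1 < (2 - β) / (2 * (β - 1)) := by
    rw [lt_div_iff₀ (by linarith)]; linarith
  linarith

/-- (2.4), upper half: `q < (2-β)/(2(β-1))`. [cite: ArmstrongVicol2025, §2.1 (2.4) p. 18] -/
theorem qExp_lt {β : ℝ} (h1 : 1 < β) (h2 : β < 4 / 3) : qExp β < (2 - β) / (2 * (β - 1)) := by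
  unfold qExp
  have h : 1 < (2 - β) / (2 * (β - 1)) := by
    rw [lt_div_iff₀ (by linarith)]; linarith
  linarith

/-- (2.3): `β = 4/3 (1 - (q-1)/(4q-1))` for `q = qExp β` ("equivalently, this means that").
[cite: ArmstrongVicol2025, §2.1 (2.3) p. 18] -/
theorem beta_eq_of_qExp {β : ℝ} (h1 : 1 < β) :
    β = 4 / 3 * (1 - (qExp β - 1) / (4 * qExp β - 1)) := by
  have hb : β - 1 ≠ 0 := by linarith
  have h4q : 4 * qExp β - 1 = (β - 1)⁻¹ := by
    unfold qExp; field_simp; ring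
  have hq1 : qExp β - 1 = (4 - 3 * β) / (4 * (β - 1)) := by
    unfold qExp; field_simp; ring
  rw [h4q, hq1]
  field_simp
  ring

/-- (2.5), second form: for `β` and `q` related by (2.3), `δ = (q-1)²/(4(q+1)(4q-1))`.
[cite: ArmstrongVicol2025, §2.1 (2.5) p. 18] -/
theorem deltaExp_eq_sq {β q : ℝ} (hq : 1 < q) (hβ : β = 4 / 3 * (1 - (q - 1) / (4 * q - 1))) :
    deltaExp β q = (q - 1) ^ 2 / (4 * (q + 1) * (4 * q - 1)) := by
  subst hβ
  unfold deltaExp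
  have h1 : 4 * q - 1 ≠ 0 := ne_of_gt (by linarith)
  have h2 : 2 * q + 2 ≠ 0 := ne_of_gt (by linarith)
  have h3 : q + 1 ≠ 0 := ne_of_gt (by linarith)
  have hden : 4 * (q + 1) * (4 * q - 1) ≠ 0 := mul_ne_zero (mul_ne_zero four_ne_zero h3) h1
  rw [eq_div_iff hden]
  simp only [div_eq_mul_inv]
  set u := (4 * q - 1)⁻¹ with hu
  set v := (2 * q + 2)⁻¹ with hv
  have i1 : (4 * q - 1) * u = 1 := mul_inv_cancel₀ h1
  have i2 : (2 * q + 2) * v = 1 := mul_inv_cancel₀ h2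
  linear_combination (2 / 3 * (2 * q + 1) * (q - 1) ^ 2 * (2 * q + 2) * v) * i1
    + (-(2 * q * (2 * q + 1) * (q - 1))) * i2

/-- `δ ∈ (0, 1/16]` ((2.5): "we fix the small parameter `δ ∈ (0, 1/16]`"), in the second form of
(2.5). [cite: ArmstrongVicol2025, §2.1 (2.5) p. 18] -/
theorem deltaExp_sq_pos_le {q : ℝ} (hq : 1 < q) :
    0 < (q - 1) ^ 2 / (4 * (q + 1) * (4 * q - 1)) ∧
      (q - 1) ^ 2 / (4 * (q + 1) * (4 * q - 1)) ≤ 1 / 16 := by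
  have hpos : 0 < 4 * (q + 1) * (4 * q - 1) := by nlinarith
  refine ⟨div_pos (by nlinarith) hpos, ?_⟩
  rw [div_le_div_iff₀ hpos (by norm_num)]
  nlinarith

/-- `0 < γ` for `β > 0`, `q > 1`. [cite: ArmstrongVicol2025, §2.1 (2.7) p. 18] -/
theorem gammaExp_pos {β q : ℝ} (hβ : 0 < β) (hq : 1 < q) : 0 < gammaExp β q := by
  unfold gammaExp
  exact div_pos (mul_pos (by linarith) hβ) (by linarith)

/-- `γ < β` for `β > 0`, `q > 1`. [cite: ArmstrongVicol2025, §2.1 (2.7) p. 18] -/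
theorem gammaExp_lt {β q : ℝ} (hβ : 0 < β) (hq : 1 < q) : gammaExp β q < β := by
  unfold gammaExp
  rw [div_lt_iff₀ (by linarith)]
  nlinarith

/-- "the exponent `γ` has been chosen so that it satisfies `q(β - γ) = β + γ`" (used at (3.52)).
[cite: ArmstrongVicol2025, Lemma 3.4, proof p. 44] -/
theorem q_mul_sub_gammaExp {β q : ℝ} (hq : 1 < q) :
    q * (β - gammaExp β q) = β + gammaExp β q := by
  unfold gammaExp
  have h : q + 1 ≠ 0 := by linarith
  field_simp
  ring

/-- The exponent of the permissible set (3.43): `2β/(q+1) = β - γ` (so the window (3.44) reads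
`½ ε_M^{-2γ} ≲ s_M ≲ 2 ε_M^{-2γ}` in the variable (3.50), p. 44).
[cite: ArmstrongVicol2025, §3.3 (3.43)–(3.44) p. 43] -/
theorem two_mul_div_eq_sub_gammaExp {β q : ℝ} (hq : 1 < q) :
    2 * β / (q + 1) = β - gammaExp β q := by
  unfold gammaExp
  have h : q + 1 ≠ 0 := by linarith
  field_simp
  ring

/-- (3.48): with `aₘ = εₘ^{β-2}` ((2.11)), `aₘ εₘ^{2+γ} = εₘ^{β+γ}`.
[cite: ArmstrongVicol2025, Lemma 3.4, proof (3.48) p. 43] -/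
theorem amp_mul_rpow_eq {x β γ : ℝ} (hx : 0 < x) :
    x ^ (β - 2) * x ^ (2 + γ) = x ^ (β + γ) := by
  rw [← rpow_add hx]; congr 1; ring

/-! ### The model recursion (3.47) -/

/-- The enhancement map is positive on positive diffusivities.
[cite: ArmstrongVicol2025, §3.3 (3.47) p. 43] -/
theorem enhanceStep_pos {a ε κ : ℝ} (hκ : 0 < κ) : 0 < enhanceStep a ε κ := by
  unfold enhanceStep; positivity

/-- Eddy diffusivities only increase toward the large scales: `κ ≤ enhanceStep a ε κ`.
[cite: ArmstrongVicol2025, §3.3 (3.47) p. 43] -/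
theorem le_enhanceStep {a ε κ : ℝ} (hκ : 0 < κ) : κ ≤ enhanceStep a ε κ := by
  unfold enhanceStep
  exact le_add_of_nonneg_right (by positivity)

/-- Positivity of every term of the model recursion. [cite: ArmstrongVicol2025, §3.3 (3.47) p. 43] -/
theorem modelDiffusivityAux_pos {a ε : ℕ → ℝ} {M : ℕ} {κ : ℝ} (hκ : 0 < κ) :
    ∀ n, 0 < modelDiffusivityAux a ε M κ n
  | 0 => hκ
  | n + 1 => enhanceStep_pos (modelDiffusivityAux_pos hκ n)

/-- Positivity of the model renormalised diffusivities.
[cite: ArmstrongVicol2025, §3.3 (3.47) p. 43] -/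
theorem modelDiffusivity_pos {a ε : ℕ → ℝ} {M : ℕ} {κ : ℝ} (hκ : 0 < κ) (m : ℕ) :
    0 < modelDiffusivity a ε M κ m :=
  modelDiffusivityAux_pos hκ _

/-- Initial value of (3.47): `κ'_M = κ`. [cite: ArmstrongVicol2025, §3.3 (3.47) p. 43] -/
theorem modelDiffusivity_top (a ε : ℕ → ℝ) (M : ℕ) (κ : ℝ) :
    modelDiffusivity a ε M κ M = κ := by
  unfold modelDiffusivity
  rw [Nat.sub_self]
  rfl

/-- The recursion (3.47), written upward: `κ'ₘ = enhanceStep aₘ₊₁ εₘ₊₁ κ'ₘ₊₁` for `m + 1 ≤ M`.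
[cite: ArmstrongVicol2025, §3.3 (3.47) p. 43] -/
theorem modelDiffusivity_succ {a ε : ℕ → ℝ} {M : ℕ} {κ : ℝ} {m : ℕ} (h : m + 1 ≤ M) :
    modelDiffusivity a ε M κ m =
      enhanceStep (a (m + 1)) (ε (m + 1)) (modelDiffusivity a ε M κ (m + 1)) := by
  unfold modelDiffusivity
  obtain ⟨j, hj⟩ : ∃ j, M - (m + 1) = j := ⟨_, rfl⟩
  have h1 : M - m = j + 1 := by omega
  have h2 : M - j = m + 1 := by omega
  rw [h1, hj]
  show enhanceStep (a (M - j)) (ε (M - j)) (modelDiffusivityAux a ε M κ j) = _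
  rw [h2]

/-- The model renormalised diffusivities increase toward the large scales: `κ'ₘ₊₁ ≤ κ'ₘ`.
[cite: ArmstrongVicol2025, §3.3 (3.47) p. 43] -/
theorem modelDiffusivity_succ_le {a ε : ℕ → ℝ} {M : ℕ} {κ : ℝ} (hκ : 0 < κ) {m : ℕ}
    (h : m + 1 ≤ M) : modelDiffusivity a ε M κ (m + 1) ≤ modelDiffusivity a ε M κ m := by
  rw [modelDiffusivity_succ h]
  exact le_enhanceStep (modelDiffusivity_pos hκ _)
/-! ### The scale sequence -/

namespace IsScaleSequence

variable {q : ℝ} {ε : ℕ → ℝ}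

/-- `εₘ₊₁ ≤ εₘ`. [cite: ArmstrongVicol2025, §2.1 (2.9) p. 19] -/
theorem succ_le (h : IsScaleSequence q ε) (m : ℕ) : ε (m + 1) ≤ ε m := by
  have := h.ratio m; have := h.pos (m + 1); nlinarith

/-- `εₘ ≤ 1` ("`εₘ ≤ Λ^{-m} ≤ 2^{-7m}`"). [cite: ArmstrongVicol2025, §2.1 (2.9) p. 19] -/
theorem le_one (h : IsScaleSequence q ε) : ∀ m, ε m ≤ 1
  | 0 => h.zero.le
  | m + 1 => (h.succ_le m).trans (h.le_one m)

/-- `εₘ ≤ 2⁻⁷` for `m ≥ 1`. [cite: ArmstrongVicol2025, §2.1 (2.9) p. 19] -/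
theorem le_inv_of_one_le (h : IsScaleSequence q ε) {m : ℕ} (hm : 1 ≤ m) : ε m ≤ 1 / 128 := by
  obtain ⟨k, rfl⟩ : ∃ k, m = k + 1 := ⟨m - 1, by omega⟩
  have h1 := h.ratio k; have h2 := h.le_one k; have h3 := h.pos (k + 1)
  nlinarith

/-- `εₘ₊₁ ≤ 2⁻⁷ εₘ`. [cite: ArmstrongVicol2025, §2.1 (2.9) p. 19] -/
theorem succ_le_mul (h : IsScaleSequence q ε) (m : ℕ) : ε (m + 1) ≤ ((2 : ℝ) ^ 7)⁻¹ * ε m := by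
  have h1 := h.ratio m
  rw [inv_mul_eq_div, le_div_iff₀ (by positivity)]
  linarith

end IsScaleSequence

/-! ### Step 1 of the proof of Lemma 3.4 -/

/-- The one-step inequality of the proof of (3.54): for the map `s ↦ r (s e + 1/s)` (`e ≥ 0`,
`r > 0`), `max{s', 1/s'} ≤ max{r, 1/r} · (1 + e) · max{s, 1/s}` ("it is easy to check that
`max{sₘ₋₁, 1/sₘ₋₁} ≤ max{sₘ, 1/sₘ}(1 + C εₘ₋₁^{2qγ∧1})`").
[cite: ArmstrongVicol2025, Lemma 3.4, proof, display before (3.54) p. 44] -/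
theorem max_step_le {s e r : ℝ} (hs : 0 < s) (he : 0 ≤ e) (hr : 0 < r) :
    max (r * (s * e + s⁻¹)) (r * (s * e + s⁻¹))⁻¹ ≤ max r r⁻¹ * ((1 + e) * max s s⁻¹) := by
  set L := max s s⁻¹ with hL
  have hsL : s ≤ L := le_max_left _ _
  have hsiL : s⁻¹ ≤ L := le_max_right _ _
  have hL1 : 1 ≤ L := by
    rcases le_or_gt 1 s with h | h
    · exact h.trans hsL
    · have : 1 ≤ s⁻¹ := by rw [inv_eq_one_div, le_div_iff₀ hs]; linarith
      exact this.trans hsiL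
  have hL0 : 0 ≤ L := zero_le_one.trans hL1
  set f := s * e + s⁻¹ with hf
  have hsi : 0 < s⁻¹ := inv_pos.mpr hs
  have hf0 : 0 < f := by positivity
  have hfL : f ≤ (1 + e) * L := by
    have : s * e ≤ L * e := mul_le_mul_of_nonneg_right hsL he
    nlinarith
  have hfiL : f⁻¹ ≤ L := by
    have h1 : s⁻¹ ≤ f := le_add_of_nonneg_left (by positivity)
    have h2 : f⁻¹ ≤ (s⁻¹)⁻¹ := by
      rw [inv_eq_one_div, inv_eq_one_div, div_le_div_iff₀ hf0 hsi]; linarith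
    rw [inv_inv] at h2
    exact h2.trans hsL
  have hR0 : 0 ≤ max r r⁻¹ := hr.le.trans (le_max_left _ _)
  refine max_le ?_ ?_
  · exact mul_le_mul (le_max_left _ _) hfL hf0.le hR0
  · rw [mul_inv]
    calc r⁻¹ * f⁻¹ ≤ max r r⁻¹ * L :=
          mul_le_mul (le_max_right _ _) hfiL (inv_pos.mpr hf0).le hR0
      _ ≤ max r r⁻¹ * ((1 + e) * L) := by
          apply mul_le_mul_of_nonneg_left _ hR0
          nlinarith

/-- The ratio factor (3.52): for `x ∈ [1 - 10t, 1 + 10t]` with `0 ≤ t ≤ 1/128` and `p ≥ 0`,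
`max{x^p, x^{-p}} ≤ exp(11 p t)` (the paper's `|(εₘ/εₘ₋₁^q)^β - 1| ≤ C εₘ₋₁`, with an explicit
constant). [cite: ArmstrongVicol2025, Lemma 3.4, proof (3.52)–(3.53) p. 44] -/
theorem max_rpow_inv_le_exp {x t p : ℝ} (hp : 0 ≤ p) (ht0 : 0 ≤ t) (ht : t ≤ 1 / 128)
    (hx1 : 1 - 10 * t ≤ x) (hx2 : x ≤ 1 + 10 * t) :
    max (x ^ p) (x ^ p)⁻¹ ≤ exp (11 * p * t) := by
  have hx0 : 0 < x := by linarith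
  have hA : x ^ p ≤ exp (11 * p * t) := by
    calc x ^ p ≤ (1 + 10 * t) ^ p := rpow_le_rpow hx0.le hx2 hp
      _ ≤ (exp (10 * t)) ^ p :=
          rpow_le_rpow (by linarith) (by linarith [add_one_le_exp (10 * t)]) hp
      _ = exp (10 * t * p) := (exp_mul _ _).symm
      _ ≤ exp (11 * p * t) := exp_le_exp.mpr (by nlinarith)
  have hB : (x ^ p)⁻¹ ≤ exp (11 * p * t) := by
    rw [← inv_rpow hx0.le]
    have h1 : 1 ≤ x * (1 + 11 * t) := by
      nlinarith [mul_le_mul_of_nonneg_right hx1 (show (0 : ℝ) ≤ 1 + 11 * t by linarith),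
        mul_nonneg ht0 (show (0 : ℝ) ≤ 1 - 110 * t by linarith)]
    have hinv : x⁻¹ ≤ 1 + 11 * t := by
      rw [inv_eq_one_div, div_le_iff₀ hx0]; nlinarith
    calc x⁻¹ ^ p ≤ (1 + 11 * t) ^ p := rpow_le_rpow (inv_pos.mpr hx0).le hinv hp
      _ ≤ (exp (11 * t)) ^ p :=
          rpow_le_rpow (by linarith) (by linarith [add_one_le_exp (11 * t)]) hp
      _ = exp (11 * t * p) := (exp_mul _ _).symm
      _ = exp (11 * p * t) := by ring_nf
  exact max_le hA hB

/-- The bookkeeping behind (3.54) as a telescoping potential: if `Lₘ ≤ exp(K eₘ) Lₘ₊₁` for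
`1 ≤ m < N` and the weights contract, `eₘ₊₁ ≤ ρ eₘ` with `ρ < 1` (here `eₘ = εₘ^θ`,
`ρ = 2^{-7θ}`), then `Lₘ ≤ L_N exp(K eₘ/(1-ρ))` for all `1 ≤ m ≤ N` — the paper's
"`∏ⱼ (1 + C εⱼ₋₁^{2γq∧1}) ≤ C`". [cite: ArmstrongVicol2025, Lemma 3.4, proof (3.54) p. 44] -/
theorem cascade_bound {L e : ℕ → ℝ} {K ρ : ℝ} {N : ℕ} (hK : 0 ≤ K)
    (hρ1 : ρ < 1) (hL : ∀ m, 0 ≤ L m) (he : ∀ m, 0 ≤ e m) (hdec : ∀ m, e (m + 1) ≤ ρ * e m)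
    (hstep : ∀ m, 1 ≤ m → m + 1 ≤ N → L m ≤ exp (K * e m) * L (m + 1)) :
    ∀ m, 1 ≤ m → m ≤ N → L m ≤ L N * exp (K / (1 - ρ) * e m) := by
  set K' := K / (1 - ρ) with hK'
  have h1ρ : 0 < 1 - ρ := by linarith
  have hK'0 : 0 ≤ K' := div_nonneg hK h1ρ.le
  have hKK' : K' * ρ = K' - K := by
    rw [hK']; field_simp; ring
  have key : ∀ n m, m + n = N → 1 ≤ m →
      L m * exp (-(K' * e m)) ≤ L N * exp (-(K' * e N)) := by
    intro n
    induction n with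
    | zero =>
      intro m hm _
      simp only [add_zero] at hm
      subst hm
      exact le_rfl
    | succ n ih =>
      intro m hm h1
      have ih' := ih (m + 1) (by omega) (by omega)
      have hst := hstep m h1 (by omega)
      have h2 : K' * e (m + 1) ≤ K' * e m - K * e m := by
        calc K' * e (m + 1) ≤ K' * (ρ * e m) := mul_le_mul_of_nonneg_left (hdec m) hK'0
          _ = (K' * ρ) * e m := by ring
          _ = (K' - K) * e m := by rw [hKK']
          _ = K' * e m - K * e m := by ring
      calc L m * exp (-(K' * e m))
          ≤ exp (K * e m) * L (m + 1) * exp (-(K' * e m)) :=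
            mul_le_mul_of_nonneg_right hst (exp_pos _).le
        _ = L (m + 1) * exp (K * e m + -(K' * e m)) := by rw [exp_add]; ring
        _ ≤ L (m + 1) * exp (-(K' * e (m + 1))) := by
            apply mul_le_mul_of_nonneg_left _ (hL _)
            exact exp_le_exp.mpr (by linarith)
        _ ≤ L N * exp (-(K' * e N)) := ih'
  intro m h1 hmN
  obtain ⟨n, hn⟩ : ∃ n, m + n = N := ⟨N - m, by omega⟩
  have h := key n m hn h1
  have hN1 : exp (-(K' * e N)) ≤ 1 := by
    rw [exp_le_one_iff]; exact neg_nonpos.mpr (mul_nonneg hK'0 (he N))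
  calc L m = L m * exp (-(K' * e m)) * exp (K' * e m) := by
        rw [mul_assoc, ← exp_add]; simp
    _ ≤ L N * exp (-(K' * e N)) * exp (K' * e m) :=
        mul_le_mul_of_nonneg_right h (exp_pos _).le
    _ ≤ L N * 1 * exp (K' * e m) := by
        apply mul_le_mul_of_nonneg_right _ (exp_pos _).le
        exact mul_le_mul_of_nonneg_left hN1 (hL N)
    _ = L N * exp (K' * e m) := by rw [mul_one]

/-- The recursion (3.47) in the rescaled variable (3.50)–(3.51): if
`κ'ₘ = ν S εₘ^{β-γ} εₘ^{2γ}` with `ν² = 9/80` (so `S = sₘ` of (3.50), since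
`aₘ εₘ^{2+γ} = εₘ^{β+γ} = εₘ^{β-γ} εₘ^{2γ}`), then
`κ'ₘ₋₁ = ν εₘ^{β-γ} (S εₘ^{2γ} + 1/S)`. [cite: ArmstrongVicol2025, Lemma 3.4, proof (3.51) p. 44] -/
theorem enhanceStep_rescale {x β γ ν S : ℝ} (hx : 0 < x) (hν : 0 < ν) (hν2 : ν ^ 2 = 9 / 80)
    (hS : 0 < S) :
    enhanceStep (x ^ (β - 2)) x (ν * S * (x ^ (β - γ) * x ^ (2 * γ))) =
      ν * x ^ (β - γ) * (S * x ^ (2 * γ) + S⁻¹) := by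
  have hE1 : (0 : ℝ) < x ^ (β - γ) := rpow_pos_of_pos hx _
  have hE2 : (0 : ℝ) < x ^ (2 * γ) := rpow_pos_of_pos hx _
  have h4 : x ^ (4 : ℕ) = x ^ (4 : ℝ) := by exact_mod_cast (rpow_natCast x 4).symm
  have hpow : (x ^ (β - 2)) ^ 2 * x ^ (4 : ℕ) = x ^ (β - γ) * x ^ (β - γ) * x ^ (2 * γ) := by
    rw [sq, h4, ← rpow_add hx, ← rpow_add hx, ← rpow_add hx, ← rpow_add hx]
    congr 1; ring
  unfold enhanceStep
  rw [show (9 : ℝ) * (x ^ (β - 2)) ^ 2 * x ^ (4 : ℕ)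
      = 80 * ν ^ 2 * (x ^ (β - γ) * x ^ (β - γ) * x ^ (2 * γ)) by
    rw [← hpow, hν2]; ring]
  have hE1' := hE1.ne'
  have hE2' := hE2.ne'
  have hν' := hν.ne'
  have hS' := hS.ne'
  field_simp

/-- The first step of the cascade lands in a universal window: if `κ ∈ [W/2, 2W]` (the window (3.44)
with `W = ε_M^{β-γ}`), `s_M = κ/(ν W E)` with `E = ε_M^{2γ} ∈ (0, 1]`, and the ratio factor `r` has
`r, 1/r ≤ R`, then `s_{M-1} = r (s_M E + 1/s_M)` satisfies `max{s_{M-1}, 1/s_{M-1}} ≤ R (2/ν + 2ν)`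
(the paper's "`s_{M-1} ≤ 2 + 2ε_M^{2γ} + Cε_{M-1} ≤ 4` and `s_{M-1} ≥ ½ - Cε_{M-1} ≥ ¼`", with
the normalisation `√(80/9)` of (3.50) kept explicit).
[cite: ArmstrongVicol2025, Lemma 3.4, proof, displays after (3.53) p. 44] -/
theorem base_window {ν W E κ S r R : ℝ} (hν : 0 < ν) (hW : 0 < W) (hE : 0 < E) (hE1 : E ≤ 1)
    (hκ1 : W / 2 ≤ κ) (hκ2 : κ ≤ 2 * W) (hS : S = κ / (ν * (W * E))) (hr : 0 < r) (hR1 : r ≤ R)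
    (hR2 : r⁻¹ ≤ R) :
    max (r * (S * E + S⁻¹)) (r * (S * E + S⁻¹))⁻¹ ≤ R * (2 / ν + 2 * ν) := by
  have hκ : 0 < κ := by linarith
  have hνW : 0 < ν * W := mul_pos hν hW
  have hν' := hν.ne'
  have hW' := hW.ne'
  have hE' := hE.ne'
  have hκ' := hκ.ne'
  have hf1 : S * E = κ / (ν * W) := by rw [hS]; field_simp
  have hf2 : S⁻¹ = ν * (W * E) / κ := by rw [hS, inv_div]
  have hR0 : 0 ≤ R := hr.le.trans hR1
  have hflo : (2 * ν)⁻¹ ≤ S * E + S⁻¹ := by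
    rw [hf1, hf2]
    have h1 : (2 * ν)⁻¹ ≤ κ / (ν * W) := by
      calc (2 * ν)⁻¹ = (W / 2) / (ν * W) := by field_simp
        _ ≤ κ / (ν * W) := div_le_div_of_nonneg_right hκ1 hνW.le
    have h2 : 0 ≤ ν * (W * E) / κ := by positivity
    exact le_add_of_le_of_nonneg h1 h2
  have hfhi : S * E + S⁻¹ ≤ 2 / ν + 2 * ν := by
    rw [hf1, hf2]
    have h1 : κ / (ν * W) ≤ 2 / ν := by
      calc κ / (ν * W) ≤ (2 * W) / (ν * W) := div_le_div_of_nonneg_right hκ2 hνW.le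
        _ = 2 / ν := mul_div_mul_right 2 ν hW'
    have h2 : ν * (W * E) / κ ≤ 2 * ν := by
      rw [div_le_iff₀ hκ]
      calc ν * (W * E) ≤ ν * (W * 1) :=
            mul_le_mul_of_nonneg_left (mul_le_mul_of_nonneg_left hE1 hW.le) hν.le
        _ ≤ ν * (2 * κ) := by
            rw [mul_one]; exact mul_le_mul_of_nonneg_left (by linarith) hν.le
        _ = 2 * ν * κ := by ring
    exact add_le_add h1 h2
  have hfpos : 0 < S * E + S⁻¹ := lt_of_lt_of_le (by positivity) hflo
  have hfi : (S * E + S⁻¹)⁻¹ ≤ 2 * ν := by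
    have := (inv_le_inv₀ hfpos (by positivity)).mpr hflo
    rwa [inv_inv] at this
  have h2ν : 2 * ν ≤ 2 / ν + 2 * ν := le_add_of_nonneg_left (by positivity)
  refine max_le ?_ ?_
  · exact mul_le_mul hR1 hfhi hfpos.le hR0
  · rw [mul_inv]
    calc r⁻¹ * (S * E + S⁻¹)⁻¹ ≤ R * (2 * ν) := mul_le_mul hR2 hfi (inv_pos.mpr hfpos).le hR0
      _ ≤ R * (2 / ν + 2 * ν) := mul_le_mul_of_nonneg_left h2ν hR0

/-- **Armstrong–Vicol, Lemma 3.4, Step 1 ((3.49) p. 44): control of the model renormalised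
diffusivities.** For `β > 0` and `q > 1`, with `γ = (q-1)β/(q+1)` ((2.7)) and amplitudes
`aₘ = εₘ^{β-2}` ((2.11)), there exist constants `0 < c ≤ C` depending only on `β` and `q`
("universal") such that: for every scale sequence `ε` with the properties (2.8)–(2.10), every
critical scale `M` and every molecular diffusivity `κ` in the permissible window (3.44)
`½ ε_M^{2β/(q+1)} ≤ κ ≤ 2 ε_M^{2β/(q+1)}`, the sequence (3.47) `κ'_M = κ`,
`κ'ₘ₋₁ = κ'ₘ + 9aₘ²εₘ⁴/(80κ'ₘ)` satisfies `c aₘ εₘ^{2+γ} ≤ κ'ₘ ≤ C aₘ εₘ^{2+γ}` for all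
`1 ≤ m ≤ M - 1`. (Printed range `{0, …, M-1}`; on `m = 0` see the module docstring. In the paper
`β ∈ (1, 4/3)` and `q = qExp β`, or any `q` closer to `1`, p. 93; Step 1 needs only `β > 0`,
`q > 1`.) [cite: ArmstrongVicol2025, Lemma 3.4 p. 43, proof Step 1 (3.49)–(3.54) p. 44] -/
theorem modelDiffusivity_bounds {β q : ℝ} (hβ : 0 < β) (hq : 1 < q) :
    ∃ c C : ℝ, 0 < c ∧ c ≤ C ∧
      ∀ ε : ℕ → ℝ, IsScaleSequence q ε → ∀ (M : ℕ) (κ : ℝ),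
        ε M ^ (2 * β / (q + 1)) / 2 ≤ κ → κ ≤ 2 * ε M ^ (2 * β / (q + 1)) →
        ∀ m : ℕ, 1 ≤ m → m < M →
          c * (ε m ^ (β - 2) * ε m ^ (2 + gammaExp β q)) ≤
              modelDiffusivity (fun n => ε n ^ (β - 2)) ε M κ m ∧
            modelDiffusivity (fun n => ε n ^ (β - 2)) ε M κ m ≤
              C * (ε m ^ (β - 2) * ε m ^ (2 + gammaExp β q)) := by
  -- the exponents
  set γ := gammaExp β q with hγ
  have hγpos : 0 < γ := gammaExp_pos hβ hq
  have hγlt : γ < β := gammaExp_lt hβ hq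
  set p := β - γ with hp
  have hppos : 0 < p := by rw [hp]; linarith
  have hqp : q * p = β + γ := q_mul_sub_gammaExp hq
  have h2b : 2 * β / (q + 1) = p := two_mul_div_eq_sub_gammaExp hq
  set θ := min 1 (2 * γ) with hθ
  have hθpos : 0 < θ := lt_min one_pos (by linarith)
  have hθ1 : θ ≤ 1 := min_le_left _ _
  have hθ2 : θ ≤ 2 * γ := min_le_right _ _
  -- the normalisation `ν = √(9/80)` of (3.50)
  set ν := Real.sqrt (9 / 80) with hν
  have hνpos : 0 < ν := Real.sqrt_pos.mpr (by norm_num)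
  have hν2 : ν ^ 2 = 9 / 80 := Real.sq_sqrt (by norm_num)
  have hν1 : ν ≤ 1 := by
    rw [hν]; exact (Real.sqrt_le_sqrt (by norm_num)).trans_eq Real.sqrt_one
  -- the constants
  set K := 11 * p + 1 with hK
  have hK0 : 0 ≤ K := by rw [hK]; linarith
  set ρ := (((2 : ℝ) ^ 7)⁻¹) ^ θ with hρ
  have hρ1 : ρ < 1 := rpow_lt_one (by positivity) (by norm_num) hθpos
  have hK'0 : 0 ≤ K / (1 - ρ) := div_nonneg hK0 (by linarith)
  set R₀ := exp (11 * p * (1 / 128)) with hR₀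
  have hR₀1 : 1 ≤ R₀ :=
    le_trans (by linarith [show 0 ≤ 11 * p * (1 / 128) by positivity])
      (add_one_le_exp (11 * p * (1 / 128)))
  set L₀ := R₀ * (2 / ν + 2 * ν) with hL₀
  have h2ν : 2 ≤ 2 / ν := by rw [le_div_iff₀ hνpos]; linarith
  have hL₀1 : 1 ≤ L₀ :=
    calc (1 : ℝ) ≤ 1 * 2 := by norm_num
      _ ≤ R₀ * (2 / ν + 2 * ν) := mul_le_mul hR₀1 (by linarith) (by norm_num) (by linarith)
  set C₁ := L₀ * exp (K / (1 - ρ)) with hC₁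
  have hE1 : 1 ≤ exp (K / (1 - ρ)) := le_trans (by linarith) (add_one_le_exp (K / (1 - ρ)))
  have hC₁1 : 1 ≤ C₁ := one_le_mul_of_one_le_of_one_le hL₀1 hE1
  have hC₁0 : 0 < C₁ := by linarith
  refine ⟨ν / C₁, ν * C₁, by positivity, ?_, ?_⟩
  · exact (div_le_self hνpos.le hC₁1).trans (le_mul_of_one_le_right hνpos.le hC₁1)
  intro ε hε M κ hκ1 hκ2 m hm1 hmM
  have εpos := hε.pos
  obtain ⟨N, rfl⟩ : ∃ N, M = N + 1 := ⟨M - 1, by omega⟩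
  have hN1 : 1 ≤ N := by omega
  have hmN : m ≤ N := by omega
  rw [h2b] at hκ1 hκ2
  have hWpos : 0 < ε (N + 1) ^ p := rpow_pos_of_pos (εpos _) _
  have hκpos : 0 < κ := lt_of_lt_of_le (by positivity) hκ1
  -- the sequences
  set a : ℕ → ℝ := fun n => ε n ^ (β - 2) with ha
  obtain ⟨k, hk⟩ : ∃ k : ℕ → ℝ, ∀ n, k n = modelDiffusivity a ε (N + 1) κ n := ⟨_, fun _ => rfl⟩
  have kpos : ∀ n, 0 < k n := fun n => by rw [hk]; exact modelDiffusivity_pos hκpos n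
  obtain ⟨s, hs⟩ : ∃ s : ℕ → ℝ, ∀ n, s n = k n / (ν * ε n ^ (β + γ)) := ⟨_, fun _ => rfl⟩
  have spos : ∀ n, 0 < s n := fun n => by
    rw [hs]; exact div_pos (kpos n) (mul_pos hνpos (rpow_pos_of_pos (εpos n) _))
  -- `εₙ^{β+γ} = εₙ^{β-γ} εₙ^{2γ}`
  have hsplit : ∀ n, ε n ^ (β + γ) = ε n ^ p * ε n ^ (2 * γ) := fun n => by
    rw [← rpow_add (εpos n)]; congr 1; rw [hp]; ring
  -- `κ'ₙ = ν sₙ εₙ^{β-γ} εₙ^{2γ}`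
  have hkS : ∀ n, k n = ν * s n * (ε n ^ p * ε n ^ (2 * γ)) := fun n => by
    rw [hs, ← hsplit]
    have := (rpow_pos_of_pos (εpos n) (β + γ)).ne'
    field_simp
  -- (3.51): the recursion in the rescaled variable
  have hrec : ∀ n, n + 1 ≤ N + 1 →
      s n = (ε (n + 1) ^ p / ε n ^ (β + γ)) *
        (s (n + 1) * ε (n + 1) ^ (2 * γ) + (s (n + 1))⁻¹) := by
    intro n hn
    have hkn : k n = ν * ε (n + 1) ^ p * (s (n + 1) * ε (n + 1) ^ (2 * γ) + (s (n + 1))⁻¹) := by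
      rw [hk, modelDiffusivity_succ hn, ← hk, hkS (n + 1)]
      exact enhanceStep_rescale (εpos _) hνpos hν2 (spos _)
    rw [hs n, hkn]
    have := (rpow_pos_of_pos (εpos n) (β + γ)).ne'
    have := hνpos.ne'
    field_simp
  -- the ratio factor `rₙ₊₁ = (εₙ₊₁/εₙ^q)^{β-γ}` and its bound, for `n ≥ 1`
  have hratio : ∀ n, 1 ≤ n →
      ε (n + 1) ^ p / ε n ^ (β + γ) = (ε (n + 1) / ε n ^ q) ^ p ∧
      0 < (ε (n + 1) / ε n ^ q) ^ p ∧
      max ((ε (n + 1) / ε n ^ q) ^ p) ((ε (n + 1) / ε n ^ q) ^ p)⁻¹ ≤ exp (11 * p * ε n) := by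
    intro n hn1
    have hyq : 0 < ε n ^ q := rpow_pos_of_pos (εpos n) q
    have hsg := hε.superGeometric n hn1
    refine ⟨?_, rpow_pos_of_pos (div_pos (εpos _) hyq) _, ?_⟩
    · rw [div_rpow (εpos _).le hyq.le, ← hqp, rpow_mul (εpos n).le]
    · refine max_rpow_inv_le_exp hppos.le (εpos n).le (hε.le_inv_of_one_le hn1) ?_ ?_
      · rw [le_div_iff₀ hyq]; exact hsg.1
      · rw [div_le_iff₀ hyq]; exact hsg.2
  -- nonnegativity of `Lₙ = max{sₙ, 1/sₙ}`
  have hLnn : ∀ n, 0 ≤ max (s n) (s n)⁻¹ := fun n => (spos n).le.trans (le_max_left _ _)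
  -- the one-step bound: `Lₙ ≤ exp(K εₙ^θ) Lₙ₊₁` for `1 ≤ n`, `n + 1 ≤ N + 1`
  have hone : ∀ n, 1 ≤ n → n + 1 ≤ N + 1 →
      max (s n) (s n)⁻¹ ≤ exp (K * ε n ^ θ) * max (s (n + 1)) (s (n + 1))⁻¹ := by
    intro n hn1 hn
    obtain ⟨hr_eq, hr_pos, hr_bd⟩ := hratio n hn1
    have hx := εpos (n + 1)
    have hy := εpos n
    have hE2pos : 0 ≤ ε (n + 1) ^ (2 * γ) := (rpow_pos_of_pos hx _).le
    have hA := max_step_le (spos (n + 1)) hE2pos hr_pos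
    have hsn : s n = (ε (n + 1) / ε n ^ q) ^ p *
        (s (n + 1) * ε (n + 1) ^ (2 * γ) + (s (n + 1))⁻¹) := by rw [hrec n hn, hr_eq]
    have hE2le : ε (n + 1) ^ (2 * γ) ≤ ε n ^ θ :=
      calc ε (n + 1) ^ (2 * γ) ≤ ε n ^ (2 * γ) := rpow_le_rpow hx.le (hε.succ_le n) (by linarith)
        _ ≤ ε n ^ θ := rpow_le_rpow_of_exponent_ge hy (hε.le_one n) hθ2
    have hεθ : ε n ≤ ε n ^ θ := by
      conv_lhs => rw [← rpow_one (ε n)]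
      exact rpow_le_rpow_of_exponent_ge hy (hε.le_one n) hθ1
    have h11 : 11 * p * ε n ≤ 11 * p * ε n ^ θ := mul_le_mul_of_nonneg_left hεθ (by positivity)
    have hexp1 : 1 + ε (n + 1) ^ (2 * γ) ≤ exp (ε n ^ θ) := by
      rw [add_comm]
      exact (add_one_le_exp _).trans (exp_le_exp.mpr hE2le)
    have hprod0 : 0 ≤ (1 + ε (n + 1) ^ (2 * γ)) * max (s (n + 1)) (s (n + 1))⁻¹ :=
      mul_nonneg (by positivity) (hLnn _)
    calc max (s n) (s n)⁻¹
        ≤ max ((ε (n + 1) / ε n ^ q) ^ p) ((ε (n + 1) / ε n ^ q) ^ p)⁻¹ *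
            ((1 + ε (n + 1) ^ (2 * γ)) * max (s (n + 1)) (s (n + 1))⁻¹) := by rw [hsn]; exact hA
      _ ≤ exp (11 * p * ε n ^ θ) * (exp (ε n ^ θ) * max (s (n + 1)) (s (n + 1))⁻¹) :=
          mul_le_mul (hr_bd.trans (exp_le_exp.mpr h11))
            (mul_le_mul_of_nonneg_right hexp1 (hLnn _)) hprod0 (exp_pos _).le
      _ = exp (K * ε n ^ θ) * max (s (n + 1)) (s (n + 1))⁻¹ := by
          rw [← mul_assoc, ← exp_add]; congr 2; rw [hK]; ring
  -- the base of the cascade: `L_{M-1} ≤ L₀`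
  have hbase : max (s N) (s N)⁻¹ ≤ L₀ := by
    obtain ⟨hr_eq, hr_pos, hr_bd⟩ := hratio N hN1
    have hrR : max ((ε (N + 1) / ε N ^ q) ^ p) ((ε (N + 1) / ε N ^ q) ^ p)⁻¹ ≤ R₀ :=
      hr_bd.trans (exp_le_exp.mpr
        (mul_le_mul_of_nonneg_left (hε.le_inv_of_one_le hN1) (by positivity)))
    have hEpos : 0 < ε (N + 1) ^ (2 * γ) := rpow_pos_of_pos (εpos _) _
    have hE1 : ε (N + 1) ^ (2 * γ) ≤ 1 := rpow_le_one (εpos _).le (hε.le_one _) (by linarith)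
    have hsM : s (N + 1) = κ / (ν * (ε (N + 1) ^ p * ε (N + 1) ^ (2 * γ))) := by
      rw [hs, hk, modelDiffusivity_top, hsplit]
    rw [hrec N le_rfl, hr_eq, hL₀]
    exact base_window hνpos hWpos hEpos hE1 hκ1 hκ2 hsM hr_pos ((le_max_left _ _).trans hrR)
      ((le_max_right _ _).trans hrR)
  -- the cascade (3.54)
  have hdec : ∀ n, ε (n + 1) ^ θ ≤ ρ * ε n ^ θ := fun n => by
    rw [hρ, ← mul_rpow (by positivity) (εpos n).le]
    exact rpow_le_rpow (εpos _).le (hε.succ_le_mul n) hθpos.le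
  have hcas := cascade_bound (L := fun n => max (s n) (s n)⁻¹) (e := fun n => ε n ^ θ)
    (N := N) hK0 hρ1 hLnn (fun n => (rpow_pos_of_pos (εpos n) _).le) hdec
    (fun n h1 h2 => hone n h1 (by omega)) m hm1 hmN
  have heθ1 : ε m ^ θ ≤ 1 := rpow_le_one (εpos m).le (hε.le_one m) hθpos.le
  have hLm : max (s m) (s m)⁻¹ ≤ C₁ := by
    refine hcas.trans ?_
    rw [hC₁]
    exact mul_le_mul hbase (exp_le_exp.mpr (mul_le_of_le_one_right hK'0 heθ1)) (exp_pos _).le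
      (zero_le_one.trans hL₀1)
  have hs_le : s m ≤ C₁ := (le_max_left _ _).trans hLm
  have hsi_le : (s m)⁻¹ ≤ C₁ := (le_max_right _ _).trans hLm
  have hs_ge : C₁⁻¹ ≤ s m := (inv_le_comm₀ (spos m) hC₁0).1 hsi_le
  -- back to `κ'ₘ = ν sₘ εₘ^{β+γ}` and `aₘ εₘ^{2+γ} = εₘ^{β+γ}`
  have hPpos : 0 < ε m ^ (β + γ) := rpow_pos_of_pos (εpos m) _
  have hkm : k m = ν * s m * ε m ^ (β + γ) := by rw [hkS m, hsplit m]
  rw [amp_mul_rpow_eq (εpos m), ← hk m, hkm]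
  constructor
  · calc ν / C₁ * ε m ^ (β + γ) = ν * C₁⁻¹ * ε m ^ (β + γ) := by rw [div_eq_mul_inv]
      _ ≤ ν * s m * ε m ^ (β + γ) :=
          mul_le_mul_of_nonneg_right (mul_le_mul_of_nonneg_left hs_ge hνpos.le) hPpos.le
  · exact mul_le_mul_of_nonneg_right (mul_le_mul_of_nonneg_left hs_le hνpos.le) hPpos.le

end ArmstrongVicol2025

end Literature.Analysis.FluidPDE
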